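import Literature.InformationTheory.QuantumCodes.DistanceThreeCodes8m
import HarnessLib

/-!
# Distance-three stabilizer codes for every length `n ≥ 38` by pasting (Yu–Bierbrauer–Dong–Chen–Oh 2013, Thm. 2)

Topic `Literature/InformationTheory/QuantumCodes` (venture QEC, cell `qec`; LIT-1 custody, the `d = 3` column — lower
side for all lengths). S. Yu, J. Bierbrauer, Y. Dong, Q. Chen, C. H. Oh, *All the stabilizer codes of distance 3*, IEEE
Trans. Inform. Theory 59 (2013) 5179 = arXiv:0901.1968 [YuEtAl2013], §III «General construction» (lit chunk p0005,
read on the page 2026-08-27):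

«**Lemma 1.** Non-degenerate optimal 1-error correcting codes of lengths `10 ≤ n ≤ 17` and `30 ≤ n ≤ 37` exist. …
Lemma 1 ensures that there exist `[17−β]` and `[37−β]` for `0 ≤ β ≤ 7`, i.e, optimal pure codes of those lengths exist
and have 6 and 7 generators respectively. For `n ≥ 38` we have the following general construction:
**Theorem 2.** For a given length `n ≥ 38` if a) `8f_m − 2 ≤ n ≤ f_{m+2} − 4` (recalling that `f_m = (4^m − 1)/3`) for
some `m ≥ 2` then we denote `f_{m+2} − 4 − n = 8α + β` with `α ≥ 0` and `0 ≤ β ≤ 7`. The stabilizer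
`[8·(2^{2m−1} − α)] ▷ [2^{2m}] ▷ [2^{2m−2}] ▷ … ▷ [2^6] ▷ [17−β]` defines a non-degenerate code `[[n, n−2m−4, 3]]`.
When `m = 2` the stabilizer is generated by `[8·(8−α)] ▷ [17−β]`. b) If `f_{m+2} − 3 ≤ n ≤ 8f_{m+1} − 3` for some
`m ≥ 2` then we denote `8f_{m+1} − 3 − n = 8α + β` with `α ≥ 0` and `0 ≤ β ≤ 7`. The stabilizer
`[8·(2^{2m} − α)] ▷ [2^{2m+1}] ▷ [2^{2m−1}] ▷ … ▷ [2^7] ▷ [37−β]` defines a non-degenerate code `[[n, n−2m−5, 3]]`.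
When `m = 2` the stabilizer is generated by `[8·(16−α)] ▷ [37−β]`. *Proof.* … all the stabilizer codes involved … are
non-degenerate … two families of codes `[8·k]` and `[2^k]` are stabilized by all `X` and all `Z` Pauli operators. As a
result the stabilizer pasting can be applied from right to left … the codes `[8·k]` and `[2^k]` have
`l_k = ⌈log k⌉ + 5` and `k + 2` stabilizers respectively while the codes `[17−β]` and `[37−β]` have at most 6 and 7
stabilizers respectively. Since `α ≥ 0` we have `⌈log(2^{2m−a} − α)⌉ ≤ 2m − a` for `a = 0,1`, the stabilizers … have
`2m+4` and `2m+5` generators respectively. … **Remark 1.** For any given `n ≥ 38` we have either construction a or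
construction b.»

## Formalisation (all PROVED; no named facts, no `sorry`)

The pasting step is `XZPureCodeExists.paste` (`StabilizerPastingXZ.lean`), the left factors are `[2^k]`
(`XZPureCodeExists.gottesman`) and `[8·k]` (`YuEtAl2013_family_8m_of_le`, `DistanceThreeCodes8m.lean`). Lemma 1's
small codes enter Theorem 2 as EXPLICIT HYPOTHESES `PureAdditiveCodeExists (17 − β) (11 − β) 3` resp.
`PureAdditiveCodeExists (37 − β) (30 − β) 3` (their printed generators — Tables IV–VIII — are not in our text source;
the tree proves `β` with `17 − β ∈ {13, 16}` and `37 − β ∈ {32, 37}`: `pureAdditiveCodeExists_13_7_3`,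
`pureAdditiveCodeExists_16_10_3`, `pureAdditiveCodeExists_32_25_3`, `pureAdditiveCodeExists_37_30_3`; the venture's
census holds kernel certificates for every cell `n ≤ 30`).

* `chainA` — `[2^{2m}] ▷ [2^{2m−2}] ▷ … ▷ [2^6] ▷ [17−β]`: a pure code of length `(4^{m+1} − 64)/3 + 17 − β` with
  `2m + 2` generators (`m ≥ 2`); `chainB` — `[2^{2m+1}] ▷ … ▷ [2^7] ▷ [37−β]`: length `2(4^{m+1} − 64)/3 + 37 − β`,
  `2m + 3` generators.
* **`YuEtAl2013_theorem2a_blocks` / `_theorem2b_blocks`** — the last step with `[8·a]`, `3 ≤ a ≤ 2^{2m−1}` resp.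
  `a ≤ 2^{2m}`: pure `[[8a + L, 8a + L − (2m+4), 3]]` resp. `− (2m+5)`.
* **`YuEtAl2013_theorem2a` / `YuEtAl2013_theorem2b`** — the printed form: `8f_m − 2 ≤ n ≤ f_{m+2} − 4` ⇒ a pure
  `[[n, n − 2m − 4, 3]]`; `f_{m+2} − 3 ≤ n ≤ 8f_{m+1} − 3` ⇒ a pure `[[n, n − 2m − 5, 3]]` (`m ≥ 2`, given Lemma 1's
  codes); `exists_range_of_ge_38` (Remark 1: every `n ≥ 38` is in range a or b for some `m ≥ 2`);
  **`YuEtAl2013_theorem2`** (packaged: for every `n ≥ 38`, given Lemma 1, a pure `[[n, n − s, 3]]` with `s = 2m+4` or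
  `2m+5` as printed).
* Unconditional instances (Lemma-1 input in the tree): `[[80,72,3]] = [8·8] ▷ [16]`, `[[64,56,3]] = [8·6] ▷ [16]`,
  `[[165,156,3]] = [8·16] ▷ [37]` (all meeting the quantum Hamming bound `n − k = ⌈log₂(3n+1)⌉`).
* **`YuEtAl2013_family_8m_optimal`** (the §II remark «`[8·m]` is optimal since `l_m + 5 = s_H`»): `2^{l+4} < 24m+1`
  ⇒ no `[[8m, 8m − l − 4, 3]]` stabilizer code at all (degenerate-safe quantum Hamming bound of
  `QuantumHammingBoundDistanceThree.lean`); `_optimal_range_one/_range_two` = the two printed ranges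
  `f_{r+1}+1 ≤ m ≤ 2^{2r+1}`, `(2^{2r+1}+1)/3 ≤ m ≤ 2^{2r}` (`r ≥ 1`) with `l_m = Nat.clog 2 m` computed.

Deliberately NOT here: Remark 1 (ii)–(iv) (optimality labels; the `l`-lengths are `DistanceThreeLPBounds.lean`, the
Hamming bound `QuantumHammingBoundDistanceThree.lean`); Lemma 1's explicit codes (§V, tables). Tree search (2026-08-27):
`PureAdditiveCodeExists.gottesmanPaste`, `Gottesman1996_perfect_codes`, `CRSS1998_theorem11_*` (the chains `[f_m]`,
`[8f_m]`), `XZPureCodeExists.*`, `YuEtAl2013_family_8m_of_le` — reused.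
-/

namespace Literature.InformationTheory.QuantumCodes

/-! ### 1. Arithmetic of the lengths -/

/-- `4^j ≡ 1 (mod 3)`. [folklore] -/
private theorem four_pow_mod_three' (j : ℕ) : 4 ^ j % 3 = 1 := by
  rw [Nat.pow_mod]; norm_num

/-- `2^{2j} = 4^j`. [folklore] -/
private theorem two_pow_two_mul (j : ℕ) : 2 ^ (2 * j) = 4 ^ j := by
  rw [pow_mul]; norm_num

/-- `6m + 40 ≤ 4^{m+1}` for `m ≥ 2` (growth of the chain lengths against the generator counts). [folklore] -/
private theorem six_mul_add_forty_le {m : ℕ} (hm : 2 ≤ m) : 6 * m + 40 ≤ 4 ^ (m + 1) := by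
  induction m, hm using Nat.le_induction with
  | base => norm_num
  | succ i _ ih => rw [pow_succ]; omega

/-! ### 2. The chains `[2^{2m}] ▷ … ▷ [2^6] ▷ [17−β]` and `[2^{2m+1}] ▷ … ▷ [2^7] ▷ [37−β]` -/

/-- **Chain (a)**: `P_m = [2^{2m}] ▷ [2^{2m−2}] ▷ … ▷ [2^6] ▷ [17−β]` is a pure code of length
`L = (4^{m+1} − 64)/3 + (17 − β)` with `2m + 2` generators, i.e. a pure `[[L, L − (2m+2), 3]]` (`m ≥ 2`; `P_2 = [17−β]`),
given the pure `[[17−β, 11−β, 3]]` of Lemma 1 (pasting «applied from right to left», each `[2^{2j}]` carrying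
`X, Z`). [cite: YuEtAl2013, §III Thm. 2 (a) and proof (chunk p0005 L60-68, L84-104)] -/
theorem chainA {β : ℕ} (hβ : β ≤ 7) (h17 : PureAdditiveCodeExists (17 - β) (11 - β) 3) {m : ℕ} (hm : 2 ≤ m) :
    PureAdditiveCodeExists ((4 ^ (m + 1) - 64) / 3 + (17 - β)) ((4 ^ (m + 1) - 64) / 3 + (17 - β) - (2 * m + 2)) 3 := by
  induction m, hm using Nat.le_induction with
  | base =>
    rw [show (4 ^ (2 + 1) - 64) / 3 + (17 - β) = 17 - β by norm_num, show 17 - β - (2 * 2 + 2) = 11 - β by omega]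
    exact h17
  | succ m hm ih =>
    -- paste `[2^{2m+2}]` (with `2m+4` generators) onto `P_m` (with `2m+2` generators)
    have hg := XZPureCodeExists.gottesman (m := 2 * m + 2) (by omega)
    have hpow : 1 ≤ 2 ^ (2 * m + 2) := Nat.one_le_two_pow
    have hstep := hg.paste hpow ih
    have hmod := four_pow_mod_three' (m + 1)
    have h22 : 2 ^ (2 * m + 2) = 4 ^ (m + 1) := by rw [show 2 * m + 2 = 2 * (m + 1) by ring, two_pow_two_mul]
    have h4s : 4 ^ (m + 1 + 1) = 4 * 4 ^ (m + 1) := by rw [pow_succ, mul_comm]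
    have hbig : 6 * m + 40 ≤ 4 ^ (m + 1) := six_mul_add_forty_le hm
    have h64 : 64 ≤ 4 ^ (m + 1) := by
      calc (64 : ℕ) = 4 ^ 3 := by norm_num
        _ ≤ 4 ^ (m + 1) := Nat.pow_le_pow_right (by norm_num) (by omega)
    rw [h22] at hstep
    have hlen : 4 ^ (m + 1) + ((4 ^ (m + 1) - 64) / 3 + (17 - β)) = (4 ^ (m + 1 + 1) - 64) / 3 + (17 - β) := by
      omega
    rw [hlen] at hstep
    have hk : (4 ^ (m + 1 + 1) - 64) / 3 + (17 - β)
        - max (4 ^ (m + 1) - (4 ^ (m + 1) - (2 * m + 2) - 2))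
            ((4 ^ (m + 1) - 64) / 3 + (17 - β) - ((4 ^ (m + 1) - 64) / 3 + (17 - β) - (2 * m + 2)) + 2)
        = (4 ^ (m + 1 + 1) - 64) / 3 + (17 - β) - (2 * (m + 1) + 2) := by
      omega
    rw [hk] at hstep
    exact hstep

/-- **Chain (b)**: `P′_m = [2^{2m+1}] ▷ [2^{2m−1}] ▷ … ▷ [2^7] ▷ [37−β]` is a pure code of length
`L′ = 2(4^{m+1} − 64)/3 + (37 − β)` with `2m + 3` generators (`m ≥ 2`; `P′_2 = [37−β]`), given the pure
`[[37−β, 30−β, 3]]` of Lemma 1. [cite: YuEtAl2013, §III Thm. 2 (b) and proof (chunk p0005 L69-80, L84-104)] -/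
theorem chainB {β : ℕ} (hβ : β ≤ 7) (h37 : PureAdditiveCodeExists (37 - β) (30 - β) 3) {m : ℕ} (hm : 2 ≤ m) :
    PureAdditiveCodeExists (2 * (4 ^ (m + 1) - 64) / 3 + (37 - β))
      (2 * (4 ^ (m + 1) - 64) / 3 + (37 - β) - (2 * m + 3)) 3 := by
  induction m, hm using Nat.le_induction with
  | base =>
    rw [show 2 * (4 ^ (2 + 1) - 64) / 3 + (37 - β) = 37 - β by norm_num,
      show 37 - β - (2 * 2 + 3) = 30 - β by omega]
    exact h37
  | succ m hm ih =>
    have hg := XZPureCodeExists.gottesman (m := 2 * m + 3) (by omega)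
    have hpow : 1 ≤ 2 ^ (2 * m + 3) := Nat.one_le_two_pow
    have hstep := hg.paste hpow ih
    have hmod := four_pow_mod_three' (m + 1)
    have h22 : 2 ^ (2 * m + 3) = 2 * 4 ^ (m + 1) := by
      rw [show 2 * m + 3 = 2 * (m + 1) + 1 by ring, pow_succ, two_pow_two_mul, mul_comm]
    have h4s : 4 ^ (m + 1 + 1) = 4 * 4 ^ (m + 1) := by rw [pow_succ, mul_comm]
    have hbig : 6 * m + 40 ≤ 4 ^ (m + 1) := six_mul_add_forty_le hm
    have h64 : 64 ≤ 4 ^ (m + 1) := by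
      calc (64 : ℕ) = 4 ^ 3 := by norm_num
        _ ≤ 4 ^ (m + 1) := Nat.pow_le_pow_right (by norm_num) (by omega)
    rw [h22] at hstep
    have hlen : 2 * 4 ^ (m + 1) + (2 * (4 ^ (m + 1) - 64) / 3 + (37 - β))
        = 2 * (4 ^ (m + 1 + 1) - 64) / 3 + (37 - β) := by
      omega
    rw [hlen] at hstep
    have hk : 2 * (4 ^ (m + 1 + 1) - 64) / 3 + (37 - β)
        - max (2 * 4 ^ (m + 1) - (2 * 4 ^ (m + 1) - (2 * m + 3) - 2))
            (2 * (4 ^ (m + 1) - 64) / 3 + (37 - β) - (2 * (4 ^ (m + 1) - 64) / 3 + (37 - β) - (2 * m + 3)) + 2)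
        = 2 * (4 ^ (m + 1 + 1) - 64) / 3 + (37 - β) - (2 * (m + 1) + 3) := by
      omega
    rw [hk] at hstep
    exact hstep

/-! ### 3. The last step with `[8·a]` -/

/-- **Theorem 2 (a), block form**: for `m ≥ 2`, `3 ≤ a ≤ 2^{2m−1}` and `β ≤ 7`, given a pure `[[17−β, 11−β, 3]]`,
the stabilizer `[8·a] ▷ [2^{2m}] ▷ … ▷ [2^6] ▷ [17−β]` is a pure `[[n, n − 2m − 4, 3]]` with
`n = 8a + (4^{m+1} − 64)/3 + 17 − β` («`[8·k]` … have `l_k = ⌈log k⌉ + 5` … Since `α ≥ 0` we have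
`⌈log(2^{2m−1} − α)⌉ ≤ 2m − 1` … `2m + 4` generators»). [cite: YuEtAl2013, §III Thm. 2 (a) (chunk p0005 L60-68, L96-104)] -/
theorem YuEtAl2013_theorem2a_blocks {m a β : ℕ} (hm : 2 ≤ m) (ha3 : 3 ≤ a) (ha : a ≤ 2 ^ (2 * m - 1)) (hβ : β ≤ 7)
    (h17 : PureAdditiveCodeExists (17 - β) (11 - β) 3) :
    PureAdditiveCodeExists (8 * a + ((4 ^ (m + 1) - 64) / 3 + (17 - β)))
      (8 * a + ((4 ^ (m + 1) - 64) / 3 + (17 - β)) - (2 * m + 4)) 3 := by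
  have hchain := chainA hβ h17 hm
  have h8 := YuEtAl2013_family_8m_of_le (m := a) (l := 2 * m - 1) (by omega) (by omega) ha
  have hstep := h8.paste (by omega) hchain
  have hmod := four_pow_mod_three' (m + 1)
  have hbig : 6 * m + 40 ≤ 4 ^ (m + 1) := six_mul_add_forty_le hm
  have h64 : 64 ≤ 4 ^ (m + 1) := by
    calc (64 : ℕ) = 4 ^ 3 := by norm_num
      _ ≤ 4 ^ (m + 1) := Nat.pow_le_pow_right (by norm_num) (by omega)
  have hk : 8 * a + ((4 ^ (m + 1) - 64) / 3 + (17 - β))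
      - max (8 * a - (8 * a - (2 * m - 1 + 5)))
          ((4 ^ (m + 1) - 64) / 3 + (17 - β) - ((4 ^ (m + 1) - 64) / 3 + (17 - β) - (2 * m + 2)) + 2)
      = 8 * a + ((4 ^ (m + 1) - 64) / 3 + (17 - β)) - (2 * m + 4) := by
    omega
  rw [hk] at hstep
  exact hstep

/-- **Theorem 2 (b), block form**: for `m ≥ 2`, `3 ≤ a ≤ 2^{2m}` and `β ≤ 7`, given a pure `[[37−β, 30−β, 3]]`, the
stabilizer `[8·a] ▷ [2^{2m+1}] ▷ … ▷ [2^7] ▷ [37−β]` is a pure `[[n, n − 2m − 5, 3]]` with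
`n = 8a + 2(4^{m+1} − 64)/3 + 37 − β`. [cite: YuEtAl2013, §III Thm. 2 (b) (chunk p0005 L69-80, L96-104)] -/
theorem YuEtAl2013_theorem2b_blocks {m a β : ℕ} (hm : 2 ≤ m) (ha3 : 3 ≤ a) (ha : a ≤ 2 ^ (2 * m)) (hβ : β ≤ 7)
    (h37 : PureAdditiveCodeExists (37 - β) (30 - β) 3) :
    PureAdditiveCodeExists (8 * a + (2 * (4 ^ (m + 1) - 64) / 3 + (37 - β)))
      (8 * a + (2 * (4 ^ (m + 1) - 64) / 3 + (37 - β)) - (2 * m + 5)) 3 := by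
  have hchain := chainB hβ h37 hm
  have h8 := YuEtAl2013_family_8m_of_le (m := a) (l := 2 * m) (by omega) (by omega) ha
  have hstep := h8.paste (by omega) hchain
  have hmod := four_pow_mod_three' (m + 1)
  have hbig : 6 * m + 40 ≤ 4 ^ (m + 1) := six_mul_add_forty_le hm
  have h64 : 64 ≤ 4 ^ (m + 1) := by
    calc (64 : ℕ) = 4 ^ 3 := by norm_num
      _ ≤ 4 ^ (m + 1) := Nat.pow_le_pow_right (by norm_num) (by omega)
  have hk : 8 * a + (2 * (4 ^ (m + 1) - 64) / 3 + (37 - β))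
      - max (8 * a - (8 * a - (2 * m + 5)))
          (2 * (4 ^ (m + 1) - 64) / 3 + (37 - β) - (2 * (4 ^ (m + 1) - 64) / 3 + (37 - β) - (2 * m + 3)) + 2)
      = 8 * a + (2 * (4 ^ (m + 1) - 64) / 3 + (37 - β)) - (2 * m + 5) := by
    omega
  rw [hk] at hstep
  exact hstep

/-! ### 4. Theorem 2 in the printed parametrization -/

/-- **Theorem 2 (a).** For `m ≥ 2` and `8f_m − 2 ≤ n ≤ f_{m+2} − 4` (`f_t = (4^t − 1)/3`), writing
`f_{m+2} − 4 − n = 8α + β` (`0 ≤ β ≤ 7`), the stabilizer `[8·(2^{2m−1} − α)] ▷ [2^{2m}] ▷ … ▷ [2^6] ▷ [17−β]` is a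
non-degenerate `[[n, n − 2m − 4, 3]]` — given the pure `[[17−β′, 11−β′, 3]]` codes of Lemma 1 (`β′ ≤ 7`).
[cite: YuEtAl2013, §III Thm. 2 (a) (chunk p0005 L60-68)] -/
theorem YuEtAl2013_theorem2a {m n : ℕ} (hm : 2 ≤ m) (hlo : 8 * ((4 ^ m - 1) / 3) - 2 ≤ n)
    (hhi : n ≤ (4 ^ (m + 2) - 1) / 3 - 4) (hL1 : ∀ β, β ≤ 7 → PureAdditiveCodeExists (17 - β) (11 - β) 3) :
    PureAdditiveCodeExists n (n - (2 * m + 4)) 3 := by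
  -- `f_{m+2} − 4 − n = 8α + β`, `a = 2^{2m−1} − α`
  set D := (4 ^ (m + 2) - 1) / 3 - 4 - n with hD
  set α := D / 8 with hα
  set β := D % 8 with hβ
  have hβ7 : β ≤ 7 := by omega
  have hDab : D = 8 * α + β := by omega
  have hmodm := four_pow_mod_three' m
  have hP16 : 16 ≤ 4 ^ m := by
    calc (16 : ℕ) = 4 ^ 2 := by norm_num
      _ ≤ 4 ^ m := Nat.pow_le_pow_right (by norm_num) hm
  have h41 : 4 ^ (m + 1) = 4 * 4 ^ m := by rw [pow_succ, mul_comm]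
  have h42 : 4 ^ (m + 2) = 16 * 4 ^ m := by rw [pow_add]; norm_num; ring
  -- `Q = 2^{2m−1}`, `2Q = 4^m`
  have hQ : 2 * 2 ^ (2 * m - 1) = 4 ^ m := by
    rw [← pow_succ', show 2 * m - 1 + 1 = 2 * m by omega, two_pow_two_mul]
  set Q := 2 ^ (2 * m - 1) with hQdef
  have hαQ : α + 3 ≤ Q := by omega
  have h := YuEtAl2013_theorem2a_blocks (m := m) (a := Q - α) (β := β) hm (by omega) (by omega) hβ7 (hL1 β hβ7)
  have hn : 8 * (Q - α) + ((4 ^ (m + 1) - 64) / 3 + (17 - β)) = n := by omega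
  rw [hn] at h
  exact h

/-- **Theorem 2 (b).** For `m ≥ 2` and `f_{m+2} − 3 ≤ n ≤ 8f_{m+1} − 3`, writing `8f_{m+1} − 3 − n = 8α + β`
(`0 ≤ β ≤ 7`), the stabilizer `[8·(2^{2m} − α)] ▷ [2^{2m+1}] ▷ … ▷ [2^7] ▷ [37−β]` is a non-degenerate
`[[n, n − 2m − 5, 3]]` — given the pure `[[37−β′, 30−β′, 3]]` codes of Lemma 1 (`β′ ≤ 7`).
[cite: YuEtAl2013, §III Thm. 2 (b) (chunk p0005 L69-80)] -/
theorem YuEtAl2013_theorem2b {m n : ℕ} (hm : 2 ≤ m) (hlo : (4 ^ (m + 2) - 1) / 3 - 3 ≤ n)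
    (hhi : n ≤ 8 * ((4 ^ (m + 1) - 1) / 3) - 3) (hL1 : ∀ β, β ≤ 7 → PureAdditiveCodeExists (37 - β) (30 - β) 3) :
    PureAdditiveCodeExists n (n - (2 * m + 5)) 3 := by
  set D := 8 * ((4 ^ (m + 1) - 1) / 3) - 3 - n with hD
  set α := D / 8 with hα
  set β := D % 8 with hβ
  have hβ7 : β ≤ 7 := by omega
  have hDab : D = 8 * α + β := by omega
  have hmodm := four_pow_mod_three' m
  have hP16 : 16 ≤ 4 ^ m := by
    calc (16 : ℕ) = 4 ^ 2 := by norm_num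
      _ ≤ 4 ^ m := Nat.pow_le_pow_right (by norm_num) hm
  have h41 : 4 ^ (m + 1) = 4 * 4 ^ m := by rw [pow_succ, mul_comm]
  have h42 : 4 ^ (m + 2) = 16 * 4 ^ m := by rw [pow_add]; norm_num; ring
  have hQ : 2 ^ (2 * m) = 4 ^ m := two_pow_two_mul m
  have hα4 : α + 3 ≤ 4 ^ m := by omega
  have h := YuEtAl2013_theorem2b_blocks (m := m) (a := 4 ^ m - α) (β := β) hm (by omega) (by omega) hβ7 (hL1 β hβ7)
  have hn : 8 * (4 ^ m - α) + (2 * (4 ^ (m + 1) - 64) / 3 + (37 - β)) = n := by omega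
  rw [hn] at h
  exact h

/-- **Remark 1**: «For any given `n ≥ 38` we have either construction a or construction b» — every `n ≥ 38` lies in
`[8f_m − 2, f_{m+2} − 4]` or in `[f_{m+2} − 3, 8f_{m+1} − 3]` for some `m ≥ 2` (the intervals tile `[38, ∞)`:
`38–81, 82–165, 166–337, 338–677, …`). [cite: YuEtAl2013, §III Remark 1 (chunk p0005 L122-123)] -/
theorem exists_range_of_ge_38 {n : ℕ} (hn : 38 ≤ n) :
    ∃ m, 2 ≤ m ∧ ((8 * ((4 ^ m - 1) / 3) - 2 ≤ n ∧ n ≤ (4 ^ (m + 2) - 1) / 3 - 4) ∨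
      ((4 ^ (m + 2) - 1) / 3 - 3 ≤ n ∧ n ≤ 8 * ((4 ^ (m + 1) - 1) / 3) - 3)) := by
  -- by induction on an upper index `M` with `n ≤ 8 f_{M+1} − 3`
  have key : ∀ M : ℕ, 1 ≤ M → ∀ n : ℕ, 38 ≤ n → n ≤ 8 * ((4 ^ (M + 1) - 1) / 3) - 3 →
      ∃ m, 2 ≤ m ∧ ((8 * ((4 ^ m - 1) / 3) - 2 ≤ n ∧ n ≤ (4 ^ (m + 2) - 1) / 3 - 4) ∨
        ((4 ^ (m + 2) - 1) / 3 - 3 ≤ n ∧ n ≤ 8 * ((4 ^ (m + 1) - 1) / 3) - 3)) := by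
    intro M hM
    induction M, hM using Nat.le_induction with
    | base => intro n hn hle; norm_num at hle; omega
    | succ M hM ih =>
      intro n hn hle
      by_cases hsmall : n ≤ 8 * ((4 ^ (M + 1) - 1) / 3) - 3
      · exact ih n hn hsmall
      · refine ⟨M + 1, by omega, ?_⟩
        by_cases ha : n ≤ (4 ^ (M + 1 + 2) - 1) / 3 - 4
        · exact Or.inl ⟨by omega, ha⟩
        · exact Or.inr ⟨by omega, hle⟩
  -- `n ≤ 8 f_{n+1} − 3`
  have hbig : n ≤ 8 * ((4 ^ (n + 1) - 1) / 3) - 3 := by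
    have hmod := four_pow_mod_three' (n + 1)
    have h1 : n + 1 ≤ 4 ^ (n + 1) := by
      have := Nat.lt_pow_self (by norm_num : 1 < 4) (n := n + 1)
      omega
    omega
  exact key n (by omega) n hn hbig

/-- **Theorem 2 (packaged)**: given the pure optimal codes of Lemma 1 (lengths `10–17` with 6 generators, `30–37` with
7 generators), for EVERY `n ≥ 38` there is a non-degenerate `[[n, n − s, 3]]` stabilizer code with `s = 2m + 4`
(range a) or `s = 2m + 5` (range b) for the `m ≥ 2` of Remark 1. [cite: YuEtAl2013, §III Thm. 2 with Remark 1 (chunk p0005 L58-80, L122-143)] -/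
theorem YuEtAl2013_theorem2 (hL1a : ∀ β, β ≤ 7 → PureAdditiveCodeExists (17 - β) (11 - β) 3)
    (hL1b : ∀ β, β ≤ 7 → PureAdditiveCodeExists (37 - β) (30 - β) 3) {n : ℕ} (hn : 38 ≤ n) :
    ∃ m, 2 ≤ m ∧
      ((8 * ((4 ^ m - 1) / 3) - 2 ≤ n ∧ n ≤ (4 ^ (m + 2) - 1) / 3 - 4 ∧ PureAdditiveCodeExists n (n - (2 * m + 4)) 3) ∨
       ((4 ^ (m + 2) - 1) / 3 - 3 ≤ n ∧ n ≤ 8 * ((4 ^ (m + 1) - 1) / 3) - 3 ∧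
          PureAdditiveCodeExists n (n - (2 * m + 5)) 3)) := by
  obtain ⟨m, hm, h⟩ := exists_range_of_ge_38 hn
  rcases h with ⟨hlo, hhi⟩ | ⟨hlo, hhi⟩
  · exact ⟨m, hm, Or.inl ⟨hlo, hhi, YuEtAl2013_theorem2a hm hlo hhi hL1a⟩⟩
  · exact ⟨m, hm, Or.inr ⟨hlo, hhi, YuEtAl2013_theorem2b hm hlo hhi hL1b⟩⟩

/-! ### 5. Unconditional instances (Lemma 1's input already in the tree) -/

/-- `[[80,72,3]] = [8·8] ▷ [16]` (range a, `m = 2`, `α = 0`, `β = 1`; `n − k = 8 = ⌈log₂ 241⌉`, meeting the quantum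
Hamming bound). [cite: YuEtAl2013, §III Thm. 2 (a) with m = 2 (chunk p0005 L66-68: «[8·(8−α)] ▷ [17−β]»)] -/
theorem pureAdditiveCodeExists_80_72_3 : PureAdditiveCodeExists 80 72 3 := by
  have h := YuEtAl2013_theorem2a_blocks (m := 2) (a := 8) (β := 1) le_rfl (by norm_num) (by norm_num) (by norm_num)
    (by simpa using pureAdditiveCodeExists_16_10_3)
  simpa using h

/-- `[[64,56,3]] = [8·6] ▷ [16]` (range a, `m = 2`, `α = 2`, `β = 1`; `n − k = 8 = ⌈log₂ 193⌉`).
[cite: YuEtAl2013, §III Thm. 2 (a) with m = 2 (chunk p0005 L66-68)] -/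
theorem pureAdditiveCodeExists_64_56_3 : PureAdditiveCodeExists 64 56 3 := by
  have h := YuEtAl2013_theorem2a_blocks (m := 2) (a := 6) (β := 1) le_rfl (by norm_num) (by norm_num) (by norm_num)
    (by simpa using pureAdditiveCodeExists_16_10_3)
  simpa using h

/-- `[[165,156,3]] = [8·16] ▷ [37]` (range b, `m = 2`, `α = β = 0`; `n − k = 9 = ⌈log₂ 496⌉`).
[cite: YuEtAl2013, §III Thm. 2 (b) with m = 2 (chunk p0005 L78-80: «[8·(16−α)] ▷ [37−β]»)] -/
theorem pureAdditiveCodeExists_165_156_3 : PureAdditiveCodeExists 165 156 3 := by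
  have h := YuEtAl2013_theorem2b_blocks (m := 2) (a := 16) (β := 0) le_rfl (by norm_num) (by norm_num) (by norm_num)
    (by simpa using pureAdditiveCodeExists_37_30_3)
  simpa using h

/-! ### 6. When `[8·m]` is optimal (the remark after the construction, §II) -/

/-- **`[8·m]` is optimal when `l + 5 = s_H`**: if `2^{l+4} < 24m + 1`, i.e. the quantum Hamming bound
`(3n+1)·2^k ≤ 2^n` (all stabilizer codes, pure or not — Gottesman 1997 §7.3, `QuantumHammingBoundDistanceThree.lean`)
excludes `l + 4` generators at length `n = 8m`, then there is no `[[8m, 8m − l − 4, 3]]` stabilizer code, so the pure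
`[[8m, 8m − l − 5, 3]]` code `[8·m]` (`YuEtAl2013_family_8m_of_le`) is optimal. «when `f_{r+1}+1 ≤ m ≤ 2^{2r+1}` and
`(2^{2r+1}+1)/3 ≤ m ≤ 2^{2r}` with `r ≥ 1` the code `[8·m]` is optimal since `l_m + 5 = s_H` in these cases. Otherwise
the code is suboptimal, i.e., `l_m + 5 = s_H + 1`.» [cite: YuEtAl2013, §II (chunk p0004 L82-87); Gottesman1997, Ch. 7 §7.3 (chunk p0059 L57-60)] -/
theorem YuEtAl2013_family_8m_optimal {m l : ℕ} (hm : 2 ≤ m) (h : 2 ^ (l + 4) < 24 * m + 1) :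
    ¬ AdditiveCodeExists (8 * m) (8 * m - (l + 4)) 3 := by
  have hl : l + 4 ≤ 8 * m := by
    by_contra hcon
    have h1 : 2 ^ (8 * m + 1) ≤ 2 ^ (l + 4) := Nat.pow_le_pow_right (by norm_num) (by omega)
    have h2 : 6 * (8 * m + 1) + 1 ≤ 2 ^ (8 * m + 1) := six_mul_add_one_le_two_pow (by omega)
    omega
  refine not_additiveCodeExists_three_of_hamming (by omega) ?_
  have e : 2 ^ (8 * m) = 2 ^ (l + 4) * 2 ^ (8 * m - (l + 4)) := by
    rw [← pow_add]; congr 1; omega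
  rw [e, show 3 * (8 * m) + 1 = 24 * m + 1 by ring]
  exact Nat.mul_lt_mul_of_pos_right h (Nat.two_pow_pos _)

/-- The first printed optimality range: `r ≥ 1`, `f_{r+1} + 1 ≤ m ≤ 2^{2r+1}` (`f_j = (4^j − 1)/3`). Then `l_m = 2r+1`,
`[8·m]` is a pure `[[8m, 8m − 2r − 6, 3]]` containing `X(8m)`, `Z(8m)`, and no `[[8m, 8m − 2r − 5, 3]]` stabilizer code
exists (`24m + 1 ≥ 8·4^{r+1} + 17 > 2^{2r+5}`). [cite: YuEtAl2013, §II (chunk p0004 L82-87)] -/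
theorem YuEtAl2013_family_8m_optimal_range_one {r m : ℕ} (hr : 1 ≤ r) (hlo : (4 ^ (r + 1) - 1) / 3 + 1 ≤ m)
    (hhi : m ≤ 2 ^ (2 * r + 1)) :
    Nat.clog 2 m = 2 * r + 1 ∧ XZPureCodeExists (8 * m) (8 * m - (2 * r + 6)) ∧
      ¬ AdditiveCodeExists (8 * m) (8 * m - (2 * r + 5)) 3 := by
  have h3 : 4 ^ (r + 1) % 3 = 1 := four_pow_mod_three' _
  have e4 : 4 ^ (r + 1) = 4 * 4 ^ r := by ring
  have e2 : 2 ^ (2 * r) = 4 ^ r := two_pow_two_mul r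
  have e2' : 2 ^ (2 * r + 1) = 2 * 4 ^ r := by rw [pow_succ, e2]; ring
  have e5 : 2 ^ (2 * r + 1 + 4) = 32 * 4 ^ r := by rw [pow_add, e2']; ring
  have h4r : 4 ≤ 4 ^ r := by
    calc (4 : ℕ) = 4 ^ 1 := by norm_num
      _ ≤ 4 ^ r := Nat.pow_le_pow_right (by norm_num) hr
  refine ⟨?_, ?_, ?_⟩
  · refine le_antisymm (Nat.clog_le_of_le_pow hhi) ?_
    refine (Nat.lt_clog_iff_pow_lt (by norm_num)).2 ?_
    rw [e2]; omega
  · exact YuEtAl2013_family_8m_of_le (by omega) (by omega) hhi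
  · exact YuEtAl2013_family_8m_optimal (by omega) (by rw [e5]; omega)

/-- The second printed optimality range: `r ≥ 1`, `(2^{2r+1} + 1)/3 ≤ m ≤ 2^{2r}`. Then `l_m = 2r`, `[8·m]` is a pure
`[[8m, 8m − 2r − 5, 3]]` containing `X(8m)`, `Z(8m)`, and no `[[8m, 8m − 2r − 4, 3]]` stabilizer code exists
(`24m + 1 ≥ 2^{2r+4} + 9`). [cite: YuEtAl2013, §II (chunk p0004 L82-87)] -/
theorem YuEtAl2013_family_8m_optimal_range_two {r m : ℕ} (hr : 1 ≤ r) (hlo : (2 ^ (2 * r + 1) + 1) / 3 ≤ m)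
    (hhi : m ≤ 2 ^ (2 * r)) :
    Nat.clog 2 m = 2 * r ∧ XZPureCodeExists (8 * m) (8 * m - (2 * r + 5)) ∧
      ¬ AdditiveCodeExists (8 * m) (8 * m - (2 * r + 4)) 3 := by
  obtain ⟨t, rfl⟩ : ∃ t, r = t + 1 := ⟨r - 1, by omega⟩
  have h3 : 4 ^ t % 3 = 1 := four_pow_mod_three' _
  have e2 : 2 ^ (2 * (t + 1)) = 4 * 4 ^ t := by rw [two_pow_two_mul]; ring
  have e2' : 2 ^ (2 * (t + 1) + 1) = 8 * 4 ^ t := by rw [pow_succ, e2]; ring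
  have e1 : 2 ^ (2 * t + 1) = 2 * 4 ^ t := by rw [pow_succ, two_pow_two_mul, mul_comm]
  have e5 : 2 ^ (2 * (t + 1) + 4) = 64 * 4 ^ t := by rw [pow_add, e2]; ring
  have h1t : 1 ≤ 4 ^ t := Nat.one_le_pow _ _ (by norm_num)
  rw [e2'] at hlo
  refine ⟨?_, ?_, ?_⟩
  · refine le_antisymm (Nat.clog_le_of_le_pow hhi) ?_
    refine (Nat.lt_clog_iff_pow_lt (by norm_num)).2 ?_
    show 2 ^ (2 * t + 1) < m
    rw [e1]; omega
  · exact YuEtAl2013_family_8m_of_le (by omega) (by omega) hhi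
  · exact YuEtAl2013_family_8m_optimal (by omega) (by rw [e5]; omega)

end Literature.InformationTheory.QuantumCodes
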